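import Mathlib
import Summits.NavierStokesRegularity.FluidComputer.AbcLatticePairingSplit
import HarnessLib

/-!
# The pairing bound `s = √2` of the skew-cut certificate IS a property of the operator
# (ASSEMBLY obligation (A4), pairing half, of `HOME/instab4/KERNEL-CHAIN.md`, part 2 of 2;
# instab4 g5 — implementation 2 of the X0 chain, cell `ns-blowup`, 2026-08-26)

HONEST FRAMING (human ruling D-0035): nothing here is a claim about Navier–Stokes blow-up.
WHAT THIS IS NOT: not NS evidence; MODEL lane (linearisation of forced Navier–Stokes about the
exact steady ABC state `U = Torus.abcFlow 1 1 1`, force `f = νU`). No certificate is moved by this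
file: it turns an ANALYTIC INPUT of the certificates into a theorem. Both X0 certifiers (instab3
`i3cert`, instab4 `cert.py`; also the selfsim/cap certificates) use the constant `s = √2` bounding
the symmetric part of the first-order part `X c(k) = Σ_{s∈{±e_j}} Û(s) × (i(k−s) × c(k−s) − c(k−s))`
of `L_R = −(1/R)|k|² + P X` (cert.py `SQRT2`, `test_lemma_S`; SKEWCUT-CERT §3 (F1)–(F2) + Lemma S;
hypothesis `hpair` of `SkewCutGalerkinTailForm.not_eigenvalue_of_structure`). Part 1
(`AbcLatticePairingSplit`) split the pairing into transport + stretch, proved (F1) (transport part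
has zero real part) and the pointwise complex Lemma S. This part:

* §1 `integral_conj_trigPoly_mul` — triple character integral on `T³` (tree orthonormality
  `Torus.integral_conj_mFourier_mul_mFourier`); `stretchPairing_eq_integral` — (F2): the lattice
  stretch pairing `Σ_k Σ_s Σ_p Σ_j conj c_p(k) c_j(k−s)(2πi s_j)Û_p(s)` IS `∫ w̄ᵀ(2πD)w` for the
  vector trigonometric polynomial `w = Σ_k e_k c(k)` (any `A, B, C`); `integral_norm_sq_trigPoly`
  — Parseval `∫‖w‖² = Σ_k‖c(k)‖²`; `abs_re_stretchPairing_le` — `|Re stretch| ≤ 2π√2 Σ_k‖c(k)‖²`.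
* §2 `abs_re_sum_inner_crossForm_le` — **(A4) PAIRING BOUND**: for every finitely supported
  transversal Cartesian family `c : ℤ³ → ℂ³`, `|Re Σ_k ⟪c(k), X c(k)⟫| ≤ √2 · Σ_k ‖c(k)‖²` — valid
  for EVERY Galerkin section of the operator (in particular the class-II cube sections of the
  certificates), with no Reynolds-number dependence.

Mathlib + the files named; no new definitions, no named facts.
-/

noncomputable section

open scoped BigOperators ComplexConjugate Matrix
open Filter Set Function MeasureTheory UnitAddTorus

namespace Summit.NavierStokesRegularity.FluidComputer.AbcLatticePairingBound

open Literature.Analysis.FunctionSpaces Literature.Analysis.FunctionSpaces.Torus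
open Literature.Analysis.FunctionSpaces.EuclideanSpace
open Literature.Analysis.FluidPDE Literature.Analysis.FluidPDE.ScalarFourier
open Literature.Analysis.FluidPDE.SteadyLattice
open AbcLatticeEigenSynthesis

open AbcLatticePairingSplit

/-! ## §1 Parseval on trigonometric polynomials: the stretch pairing is an integral -/

/-- **Triple character integral** (orthonormality of the characters, tree
`Torus.integral_conj_mFourier_mul_mFourier`): for finitely many frequencies,
`∫ conj(Σ_{k∈F} a_k e_k) · (Σ_{s∈G} m_s e_s) · (Σ_{k'∈F'} b_{k'} e_{k'}) = Σ_k Σ_s Σ_{k'} [k = s + k'] conj(a_k) m_s b_{k'}`.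
[folklore] -/
theorem integral_conj_trigPoly_mul (F G F' : Finset (Fin 3 → ℤ)) (a m b : (Fin 3 → ℤ) → ℂ) :
    ∫ x : UnitAddTorus (Fin 3), conj (∑ k ∈ F, a k * mFourier k x) *
        ((∑ s ∈ G, m s * mFourier s x) * ∑ k' ∈ F', b k' * mFourier k' x) =
      ∑ k ∈ F, ∑ s ∈ G, ∑ k' ∈ F', if k = s + k' then conj (a k) * m s * b k' else 0 := by
  classical
  -- pointwise expansion of the integrand
  have hpt : ∀ x : UnitAddTorus (Fin 3), conj (∑ k ∈ F, a k * mFourier k x) *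
      ((∑ s ∈ G, m s * mFourier s x) * ∑ k' ∈ F', b k' * mFourier k' x) =
      ∑ k ∈ F, ∑ s ∈ G, ∑ k' ∈ F', (conj (a k) * m s * b k') *
        (conj (mFourier k x) * mFourier (s + k') x) := by
    intro x
    rw [map_sum, Finset.sum_mul]
    refine Finset.sum_congr rfl fun k _ => ?_
    rw [Finset.sum_mul_sum, Finset.mul_sum]
    refine Finset.sum_congr rfl fun s _ => ?_
    rw [Finset.mul_sum]
    refine Finset.sum_congr rfl fun k' _ => ?_
    rw [mFourier_add, map_mul]
    ring
  simp_rw [hpt]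
  have hint : ∀ (k s k' : Fin 3 → ℤ), Integrable (fun x : UnitAddTorus (Fin 3) =>
      (conj (a k) * m s * b k') * (conj (mFourier k x) * mFourier (s + k') x)) := by
    intro k s k'
    exact (continuous_const.mul ((Complex.continuous_conj.comp (mFourier k).continuous).mul
      (mFourier (s + k')).continuous)).integrable_unitAddTorus
  rw [integral_finsetSum _ fun k _ => integrable_finsetSum _ fun s _ =>
    integrable_finsetSum _ fun k' _ => hint k s k']
  refine Finset.sum_congr rfl fun k _ => ?_
  rw [integral_finsetSum _ fun s _ => integrable_finsetSum _ fun k' _ => hint k s k']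
  refine Finset.sum_congr rfl fun s _ => ?_
  rw [integral_finsetSum _ fun k' _ => hint k s k']
  refine Finset.sum_congr rfl fun k' _ => ?_
  rw [integral_const_mul, Torus.integral_conj_mFourier_mul_mFourier]
  split_ifs <;> simp

/-- Components of a vector trigonometric polynomial: `(Σ_{k∈F} e_k(x) c(k))_p = Σ_{k∈F} c_p(k) e_k(x)`.
[folklore] -/
theorem trigPoly_apply (c : (Fin 3 → ℤ) → EuclideanSpace ℂ (Fin 3)) (F : Finset (Fin 3 → ℤ))
    (x : UnitAddTorus (Fin 3)) (pp : Fin 3) :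
    (∑ k ∈ F, mFourier k x • c k) pp = ∑ k ∈ F, c k pp * mFourier k x := by
  simp only [WithLp.ofLp_sum, WithLp.ofLp_smul, Finset.sum_apply, Pi.smul_apply, smul_eq_mul]
  exact Finset.sum_congr rfl fun k _ => mul_comm _ _

/-- A vector trigonometric polynomial is continuous. [folklore] -/
theorem continuous_trigPoly (c : (Fin 3 → ℤ) → EuclideanSpace ℂ (Fin 3)) (F : Finset (Fin 3 → ℤ)) :
    Continuous fun x : UnitAddTorus (Fin 3) => ∑ k ∈ F, mFourier k x • c k :=
  continuous_finsetSum _ fun k _ => (mFourier k).continuous.smul continuous_const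

/-- **(F2) The stretch pairing is the integral of the Jacobian form of the synthesised field**
(lattice ↔ physical space): with `w(x) = Σ_{k∈F} e_k(x) c(k)` and `c` vanishing off `F`,
`Σ_{k∈F} Σ_s Σ_p Σ_j conj c_p(k) · c_j(k−s) (2πi s_j) Û_p(s) = ∫ Σ_p Σ_j conj(w_p) (Σ_s e_s (2πi s_j) Û_p(s)) w_j`
— i.e. the lattice sum IS `∫ conj(w)ᵀ (∇U)^{sym-relevant} w` (any `A, B, C`). -/
theorem stretchPairing_eq_integral (A B C : ℝ) (c : (Fin 3 → ℤ) → EuclideanSpace ℂ (Fin 3))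
    (F : Finset (Fin 3 → ℤ)) (hcF : ∀ k ∉ F, c k = 0) :
    ∑ k ∈ F, ∑ s ∈ Torus.abcFreq, ∑ pp : Fin 3, ∑ j : Fin 3,
      conj (c k pp) * (c (k - s) j * (2 * Real.pi * Complex.I * ((s j : ℤ) : ℂ)) *
        Torus.abcCoeff A B C s pp) =
    ∫ x : UnitAddTorus (Fin 3), ∑ pp : Fin 3, ∑ j : Fin 3,
      conj ((∑ k ∈ F, mFourier k x • c k) pp) *
        ((∑ s ∈ Torus.abcFreq, mFourier s x * (2 * Real.pi * Complex.I * ((s j : ℤ) : ℂ)) *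
            Torus.abcCoeff A B C s pp) * (∑ k ∈ F, mFourier k x • c k) j) := by
  classical
  have hsym : ∀ (x : UnitAddTorus (Fin 3)) (pp j : Fin 3),
      (∑ s ∈ Torus.abcFreq, mFourier s x * (2 * Real.pi * Complex.I * ((s j : ℤ) : ℂ)) *
          Torus.abcCoeff A B C s pp) =
      ∑ s ∈ Torus.abcFreq, (2 * Real.pi * Complex.I * ((s j : ℤ) : ℂ) * Torus.abcCoeff A B C s pp) *
        mFourier s x := by
    intro x pp j
    exact Finset.sum_congr rfl fun s _ => by ring
  simp_rw [trigPoly_apply, hsym]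
  -- the (p, j) integrands are continuous, hence integrable
  have hcont : ∀ pp j : Fin 3, Continuous fun x : UnitAddTorus (Fin 3) =>
      conj (∑ k ∈ F, c k pp * mFourier k x) *
        ((∑ s ∈ Torus.abcFreq, (2 * Real.pi * Complex.I * ((s j : ℤ) : ℂ) * Torus.abcCoeff A B C s pp) *
            mFourier s x) * ∑ k ∈ F, c k j * mFourier k x) := by
    intro pp j
    refine (Complex.continuous_conj.comp ?_).mul (Continuous.mul ?_ ?_)
    · exact continuous_finsetSum _ fun k _ => continuous_const.mul (mFourier k).continuous
    · exact continuous_finsetSum _ fun s _ => continuous_const.mul (mFourier s).continuous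
    · exact continuous_finsetSum _ fun k _ => continuous_const.mul (mFourier k).continuous
  -- per component pair: orthonormality
  have key : ∀ pp j : Fin 3, ∫ x : UnitAddTorus (Fin 3), conj (∑ k ∈ F, c k pp * mFourier k x) *
      ((∑ s ∈ Torus.abcFreq, (2 * Real.pi * Complex.I * ((s j : ℤ) : ℂ) * Torus.abcCoeff A B C s pp) *
          mFourier s x) * ∑ k ∈ F, c k j * mFourier k x) =
      ∑ k ∈ F, ∑ s ∈ Torus.abcFreq, conj (c k pp) * (c (k - s) j *
        (2 * Real.pi * Complex.I * ((s j : ℤ) : ℂ)) * Torus.abcCoeff A B C s pp) := by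
    intro pp j
    rw [integral_conj_trigPoly_mul]
    refine Finset.sum_congr rfl fun k _ => Finset.sum_congr rfl fun s _ => ?_
    rw [Finset.sum_eq_single (k - s)]
    · rw [if_pos (by abel)]
      ring
    · intro k' _ hk'
      rw [if_neg]
      intro h
      apply hk'
      rw [h]
      abel
    · intro h
      rw [hcF _ h]
      simp
  rw [integral_finsetSum _ fun pp _ =>
    integrable_finsetSum _ fun j _ => (hcont pp j).integrable_unitAddTorus]
  simp_rw [integral_finsetSum _ fun j _ => (hcont _ j).integrable_unitAddTorus, key]
  -- reorder the finite sums: `Σ_k Σ_s Σ_p Σ_j = Σ_p Σ_j Σ_k Σ_s`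
  refine Eq.trans (Finset.sum_congr rfl fun k _ => Finset.sum_comm) ?_
  refine Eq.trans Finset.sum_comm ?_
  refine Finset.sum_congr rfl fun pp _ => ?_
  refine Eq.trans (Finset.sum_congr rfl fun k _ => Finset.sum_comm) ?_
  exact Finset.sum_comm

/-- **Parseval for vector trigonometric polynomials**: `∫ ‖Σ_{k∈F} e_k(x) c(k)‖² dx = Σ_{k∈F} ‖c(k)‖²`.
[folklore] -/
theorem integral_norm_sq_trigPoly (c : (Fin 3 → ℤ) → EuclideanSpace ℂ (Fin 3)) (F : Finset (Fin 3 → ℤ)) :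
    ∫ x : UnitAddTorus (Fin 3), ‖∑ k ∈ F, mFourier k x • c k‖ ^ 2 = ∑ k ∈ F, ‖c k‖ ^ 2 := by
  classical
  -- complexify the integrand
  have hC : ∀ x : UnitAddTorus (Fin 3), ((‖∑ k ∈ F, mFourier k x • c k‖ ^ 2 : ℝ) : ℂ) =
      ∑ pp : Fin 3, conj (∑ k ∈ F, c k pp * mFourier k x) *
        ((∑ s ∈ ({0} : Finset (Fin 3 → ℤ)), 1 * mFourier s x) * ∑ k' ∈ F, c k' pp * mFourier k' x) := by
    intro x
    rw [EuclideanSpace.norm_sq_eq]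
    push_cast
    refine Finset.sum_congr rfl fun pp _ => ?_
    rw [Finset.sum_singleton, mFourier_zero, ContinuousMap.one_apply, one_mul, one_mul, trigPoly_apply,
      Complex.conj_mul']
  have hcont : ∀ pp : Fin 3, Continuous fun x : UnitAddTorus (Fin 3) =>
      conj (∑ k ∈ F, c k pp * mFourier k x) *
        ((∑ s ∈ ({0} : Finset (Fin 3 → ℤ)), 1 * mFourier s x) * ∑ k' ∈ F, c k' pp * mFourier k' x) := by
    intro pp
    refine (Complex.continuous_conj.comp ?_).mul (Continuous.mul ?_ ?_)
    · exact continuous_finsetSum _ fun k _ => continuous_const.mul (mFourier k).continuous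
    · exact continuous_finsetSum _ fun s _ => continuous_const.mul (mFourier s).continuous
    · exact continuous_finsetSum _ fun k _ => continuous_const.mul (mFourier k).continuous
  -- complexify the right-hand side
  have hR : ((∑ k ∈ F, ‖c k‖ ^ 2 : ℝ) : ℂ) = ∑ k ∈ F, ∑ pp : Fin 3, conj (c k pp) * c k pp := by
    rw [Finset.sum_congr rfl fun k _ => EuclideanSpace.norm_sq_eq (c k)]
    push_cast
    exact Finset.sum_congr rfl fun k _ => Finset.sum_congr rfl fun pp _ => (Complex.conj_mul' _).symm
  apply Complex.ofReal_injective
  rw [← integral_complex_ofReal, hR]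
  simp_rw [hC]
  rw [integral_finsetSum _ fun pp _ => (hcont pp).integrable_unitAddTorus]
  simp_rw [integral_conj_trigPoly_mul]
  refine Eq.trans Finset.sum_comm ?_
  refine Finset.sum_congr rfl fun k hk => Finset.sum_congr rfl fun pp _ => ?_
  rw [Finset.sum_singleton, Finset.sum_eq_single k]
  · rw [if_pos (zero_add k).symm, mul_one]
  · intro k' _ hk'
    rw [if_neg]
    intro h
    exact hk' (by rw [h, zero_add])
  · intro h
    exact absurd hk h

/-- **(F2) + Lemma S: the stretch pairing is bounded by `2π√2·Σ_k ‖c(k)‖²`** for the ABC flow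
`U = Torus.abcFlow 1 1 1` and every finitely supported Cartesian coefficient family `c` —
`stretchPairing_eq_integral`, the pointwise bound `abs_re_jacobianForm_le'` at every point of
the torus, `|∫ Re| ≤ ∫ |Re|`, and Parseval `integral_norm_sq_trigPoly`. This is the operator-level
form of SKEWCUT-CERT Lemma S (`SkewCutCertificate.abc_strain_form_abs_le`, cert.py `test_lemma_S`). -/
theorem abs_re_stretchPairing_le (c : (Fin 3 → ℤ) → EuclideanSpace ℂ (Fin 3)) (F : Finset (Fin 3 → ℤ))
    (hcF : ∀ k ∉ F, c k = 0) :
    |(∑ k ∈ F, ∑ s ∈ Torus.abcFreq, ∑ pp : Fin 3, ∑ j : Fin 3,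
      conj (c k pp) * (c (k - s) j * (2 * Real.pi * Complex.I * ((s j : ℤ) : ℂ)) *
        Torus.abcCoeff 1 1 1 s pp)).re| ≤
      2 * Real.pi * Real.sqrt 2 * ∑ k ∈ F, ‖c k‖ ^ 2 := by
  classical
  rw [stretchPairing_eq_integral 1 1 1 c F hcF]
  -- the synthesised field and the integrand
  set v : UnitAddTorus (Fin 3) → EuclideanSpace ℂ (Fin 3) := fun x => ∑ k ∈ F, mFourier k x • c k
    with hv
  have hvc : Continuous v := continuous_trigPoly c F
  set Φ : UnitAddTorus (Fin 3) → ℂ := fun x => ∑ pp : Fin 3, ∑ j : Fin 3, conj (v x pp) *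
      ((∑ s ∈ Torus.abcFreq, mFourier s x * (2 * Real.pi * Complex.I * ((s j : ℤ) : ℂ)) *
          Torus.abcCoeff 1 1 1 s pp) * v x j) with hΦ
  have hΦc : Continuous Φ := by
    refine continuous_finsetSum _ fun pp _ => continuous_finsetSum _ fun j _ => ?_
    have hp : Continuous fun x => v x pp := (PiLp.continuous_apply 2 _ pp).comp hvc
    have hj : Continuous fun x => v x j := (PiLp.continuous_apply 2 _ j).comp hvc
    refine (Complex.continuous_conj.comp hp).mul (Continuous.mul ?_ hj)
    exact continuous_finsetSum _ fun s _ =>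
      ((mFourier s).continuous.mul continuous_const).mul continuous_const
  change |(∫ x, Φ x).re| ≤ _
  have hre : (∫ x, Φ x).re = ∫ x, (Φ x).re := by
    have h := integral_re hΦc.integrable_unitAddTorus
    simpa using h.symm
  rw [hre]
  have hpt : ∀ x, |(Φ x).re| ≤ 2 * Real.pi * Real.sqrt 2 * ‖v x‖ ^ 2 := fun x =>
    abs_re_jacobianForm_le' x (v x)
  have hP : ∫ x, ‖v x‖ ^ 2 = ∑ k ∈ F, ‖c k‖ ^ 2 := integral_norm_sq_trigPoly c F
  calc |∫ x, (Φ x).re| ≤ ∫ x, |(Φ x).re| := abs_integral_le_integral_abs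
    _ ≤ ∫ x, 2 * Real.pi * Real.sqrt 2 * ‖v x‖ ^ 2 :=
        integral_mono (continuous_abs.comp (Complex.continuous_re.comp hΦc)).integrable_unitAddTorus
          (continuous_const.mul ((continuous_norm.comp hvc).pow 2)).integrable_unitAddTorus hpt
    _ = 2 * Real.pi * Real.sqrt 2 * ∑ k ∈ F, ‖c k‖ ^ 2 := by rw [integral_const_mul, hP]

/-! ## §2 (A4) The pairing bound `s = √2` -/

/-- **(A4) PAIRING BOUND — the certificates' input constant `s = √2` is a theorem about the
operator.** For `U = Torus.abcFlow 1 1 1` (coefficients `Û = Torus.abcCoeff 1 1 1` on the shell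
`{±e_j}`) and every finitely supported transversal Cartesian family `c : ℤ³ → ℂ³` (`k·c(k) = 0`),
the first-order part `X c (k) = Σ_s Û(s) × (i(k−s) × c(k−s) − c(k−s))` of the certifiers' operator
`L_R = −(1/R)|k|² + P X` (cert.py/galerkin.py; `AbcLatticeEigenSynthesis.lerayCoeff_linSym_abcFlow`
identifies `−2π·P X` with the tree's linearised symbol) satisfies
`|Re Σ_k ⟪c(k), X c(k)⟫| ≤ √2 · Σ_k ‖c(k)‖²`.
(The Leray projector is not needed in the pairing: `c(k) ⊥ k`.) This is hypothesis `hpair` of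
`SkewCutGalerkinTailForm.not_eigenvalue_of_structure` for every Galerkin section, and SKEWCUT-CERT
§3 (F1)–(F2) + Lemma S. MODEL statement (linearised operator about forced ABC); not NS. -/
theorem abs_re_sum_inner_crossForm_le (c : (Fin 3 → ℤ) → EuclideanSpace ℂ (Fin 3))
    (F : Finset (Fin 3 → ℤ)) (hcF : ∀ k ∉ F, c k = 0)
    (hdiv : ∀ k : Fin 3 → ℤ, (∑ jj : Fin 3, ((k jj : ℤ) : ℂ) * (c k) jj) = 0) :
    |(∑ k ∈ F, (inner ℂ (c k) (∑ s ∈ Torus.abcFreq,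
        (WithLp.toLp 2 (crossProduct (WithLp.ofLp (Torus.abcCoeff 1 1 1 s))
          (Complex.I • crossProduct (fun j => (((k - s) j : ℤ) : ℂ)) (WithLp.ofLp (c (k - s))) -
            WithLp.ofLp (c (k - s)))) : EuclideanSpace ℂ (Fin 3))) : ℂ)).re| ≤
      Real.sqrt 2 * ∑ k ∈ F, ‖c k‖ ^ 2 := by
  rw [Finset.sum_congr rfl fun k _ => inner_crossForm_eq 1 1 1 c k (hdiv k), ← Finset.mul_sum]
  simp only [mul_add, Finset.sum_add_distrib]
  have hT := re_transportPairing_eq_zero 1 1 1 c F hcF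
  have hS := abs_re_stretchPairing_le c F hcF
  have hconst : (-(1 / (2 * (Real.pi : ℂ)))) = (((-(1 / (2 * Real.pi))) : ℝ) : ℂ) := by push_cast; ring
  rw [hconst, Complex.add_re, Complex.re_ofReal_mul, Complex.re_ofReal_mul, hT, mul_zero, zero_add,
    abs_mul, abs_neg, abs_of_pos (by positivity : (0 : ℝ) < 1 / (2 * Real.pi))]
  calc 1 / (2 * Real.pi) * |(∑ k ∈ F, ∑ s ∈ Torus.abcFreq, ∑ pp : Fin 3, ∑ j : Fin 3,
          conj (c k pp) * (c (k - s) j * (2 * Real.pi * Complex.I * ((s j : ℤ) : ℂ)) *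
            Torus.abcCoeff 1 1 1 s pp)).re|
        ≤ 1 / (2 * Real.pi) * (2 * Real.pi * Real.sqrt 2 * ∑ k ∈ F, ‖c k‖ ^ 2) :=
          mul_le_mul_of_nonneg_left hS (by positivity)
    _ = Real.sqrt 2 * ∑ k ∈ F, ‖c k‖ ^ 2 := by field_simp

end Summit.NavierStokesRegularity.FluidComputer.AbcLatticePairingBound

end
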